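import Summits.Ventures.PercRepro.C025ProfileOneCircuitC

/-!
# THE ROW `(q, q+1)` ON THIN MATROIDS WITH A 3-CIRCUIT — part A: STRUCTURE (night-3 g15)
`proofs/NIGHT3-G14-SIZE.md` §5e. A finite SIMPLE matroid (`hsimple`: every set of `≤ 2` points has full rank) with a 3-circuit `K`
(`K ⊆ E`, `|K| = 3`, `ρ(K) = 2`) in which every rank-`q` set has at most `q + 1` points (THIN, `hthin`), `q ≥ 4`, satisfies the
row `(q, q+1)` of C-032 and its Hall form (C-033) for EVERY size `n = |E|` — the whole thin regime at girth 3, below and above the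
simple rule's boundary `2n ≥ 5q − 1` of `C025ProfileThinRowF`, and beyond the one-short-circuit class 𝒞(q) of `C025ProfileOneCircuitB`.
The certificate is the HYBRID RULE: the cascade weights of 𝒞(q) by `K`-type on the sets `B ∪ {x}`, `x` not an inner point of `B`, plus a
uniform payment `σ = 4/(3f)` (`f = n − q − 1`) on the `(q+2)`-sets `B ∪ {y, x}` for every independent `q`-set `B` with `≤ 1` point of `K`
and an inner point `y` (`ρ(B ∪ {y}) = q`). Everything is stated with the rank function `rkN` alone (no circuits): the tools are
submodularity in `ℕ` (`rkN_inter_add_union_le`) and the discrete intermediate-value lemma `exists_rkN_eq_between` (along a chain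
`X ⊆ Z ⊆ Y` the rank takes every value between `ρ(X)` and `ρ(Y)` while the nullity `|Z| − ρ(Z)` never decreases), which turns thinness
into «every set `X ⊆ Y` with `ρ(X) ≤ q ≤ ρ(Y)` has nullity `≤ 1`» (`card_le_rkN_add_one_of_between`). PART A (this file): the
structure — an independent `q`-set has at most one inner point (`inner_unique`), a `(q+1)`-set of rank `q` is closed
(`rkN_insert_eq_succ_of_card_succ`), the third point of `K` is the inner point of a `2K`-set (`rkN_insert_eq_of_twoK`), the two shapes
of a `(q+2)`-set `S` of rank `q + 1`: `K ⊆ S` (`S ∖ {c}` has rank `q + 1` for `c ∈ K` and rank `q` for `c ∉ K`) and `K ⊄ S` (at most two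
coloops, `card_col_le_two`, and the σ-loaders of `S` inject into `col S × (S ∖ col S)`, `mem_image_of_inner`). No `def`, no `instance`,
no notation.
-/
open scoped Matroid
namespace PercRepro
open Set Finset ThmH Staged
namespace ThinTriangle
variable {α : Type} [DecidableEq α] {M : Matroid α} [M.Finite]

/-- Submodularity in `ℕ`: `ρ(X ∩ Y) + ρ(X ∪ Y) ≤ ρ(X) + ρ(Y)`. -/
theorem rkN_inter_add_union_le (X Y : Finset α) : rkN M (X ∩ Y) + rkN M (X ∪ Y) ≤ rkN M X + rkN M Y := by
  have h := M.eRk_inter_add_eRk_union_le (X : Set α) (Y : Set α)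
  rw [← Finset.coe_inter, ← Finset.coe_union, ← coe_rkN (X ∩ Y), ← coe_rkN (X ∪ Y), ← coe_rkN X, ← coe_rkN Y] at h
  exact_mod_cast h

/-- **Discrete intermediate value with monotone nullity**: for `X ⊆ Y` with `ρ(X) ≤ q ≤ ρ(Y)` there is `Z` between them of rank
exactly `q` whose nullity `|Z| − ρ(Z)` is at least that of `X` (induction on `|Y ∖ X|`, adding one point at a time). -/
theorem exists_rkN_eq_between (q : ℕ) : ∀ (k : ℕ) (X Y : Finset α), X ⊆ Y → (Y \ X).card = k →
    rkN M X ≤ q → q ≤ rkN M Y →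
    ∃ Z, X ⊆ Z ∧ Z ⊆ Y ∧ rkN M Z = q ∧ X.card + rkN M Z ≤ Z.card + rkN M X := by
  intro k
  induction k with
  | zero =>
    intro X Y hXY hk hXq hqY
    have hYX : Y \ X = ∅ := Finset.card_eq_zero.mp hk
    have hEq : X = Y := by
      apply Finset.Subset.antisymm hXY
      intro y hy
      by_contra hyX
      have : y ∈ Y \ X := Finset.mem_sdiff.mpr ⟨hy, hyX⟩
      rw [hYX] at this
      exact Finset.notMem_empty y this
    subst hEq
    exact ⟨X, Finset.Subset.refl X, Finset.Subset.refl X, le_antisymm hXq hqY, le_refl _⟩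
  | succ k ih =>
    intro X Y hXY hk hXq hqY
    rcases Nat.lt_or_ge (rkN M X) q with hlt | hge
    · obtain ⟨y, hy⟩ : (Y \ X).Nonempty := Finset.card_pos.mp (by omega)
      have hyY : y ∈ Y := (Finset.mem_sdiff.mp hy).1
      have hyX : y ∉ X := (Finset.mem_sdiff.mp hy).2
      have h1 : insert y X ⊆ Y := Finset.insert_subset hyY hXY
      have h2 : (Y \ insert y X).card = k := by
        have e : Y \ insert y X = (Y \ X).erase y := by
          ext z
          simp only [Finset.mem_sdiff, Finset.mem_insert, Finset.mem_erase, not_or]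
          tauto
        have := Finset.card_erase_of_mem hy
        rw [e]
        omega
      have h5 := rkN_insert_le (M := M) (X := X) y
      have h3 : rkN M (insert y X) ≤ q := by omega
      obtain ⟨Z, hXZ, hZY, hZq, hnull⟩ := ih (insert y X) Y h1 h2 h3 hqY
      refine ⟨Z, (Finset.subset_insert y X).trans hXZ, hZY, hZq, ?_⟩
      have h4 : (insert y X).card = X.card + 1 := Finset.card_insert_of_notMem hyX
      omega
    · exact ⟨X, Finset.Subset.refl X, hXY, le_antisymm hXq hge, le_refl _⟩

/-- **Thinness bounds the nullity**: if `X ⊆ Y ⊆ E` with `ρ(X) ≤ q ≤ ρ(Y)`, then `|X| ≤ ρ(X) + 1`. -/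
theorem card_le_rkN_add_one_of_between {q : ℕ} (hthin : ∀ X ⊆ gr M, rkN M X = q → X.card ≤ q + 1)
    {X Y : Finset α} (hXY : X ⊆ Y) (hYg : Y ⊆ gr M) (hXq : rkN M X ≤ q) (hqY : q ≤ rkN M Y) :
    X.card ≤ rkN M X + 1 := by
  obtain ⟨Z, _, hZY, hZq, hnull⟩ := exists_rkN_eq_between q _ X Y hXY rfl hXq hqY
  have := hthin Z (hZY.trans hYg) hZq
  omega

omit [DecidableEq α] in
/-- A rank-`q` set has `q` or `q + 1` points in the thin regime. -/
theorem card_eq_or_eq_of_rkN_eq {q : ℕ} (hthin : ∀ X ⊆ gr M, rkN M X = q → X.card ≤ q + 1)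
    {B : Finset α} (hBg : B ⊆ gr M) (hB : rkN M B = q) : B.card = q ∨ B.card = q + 1 := by
  have h1 := hthin B hBg hB
  have h2 : q ≤ B.card := hB ▸ rkN_le_card B
  omega

/-- A point that is not an inner point of a rank-`q` set raises the rank to `q + 1`. -/
theorem rkN_insert_eq_succ_of_ne {q : ℕ} {B : Finset α} (hB : rkN M B = q) {x : α}
    (hx : rkN M (insert x B) ≠ q) : rkN M (insert x B) = q + 1 := by
  have h1 := rkN_insert_le (M := M) (X := B) x
  have h2 : rkN M B ≤ rkN M (insert x B) := rkN_mono (Finset.subset_insert x B)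
  omega

/-- `ρ(B ∪ {y}) = q` and `ρ(B ∪ {x}) = q + 1` give `ρ(B ∪ {x, y}) = q + 1`. -/
theorem rkN_insert_insert_eq_succ {q : ℕ} {B : Finset α} {x y : α} (hy : rkN M (insert y B) = q)
    (hx : rkN M (insert x B) = q + 1) : rkN M (insert x (insert y B)) = q + 1 := by
  have h1 := rkN_insert_le (M := M) (X := insert y B) x
  have h2 : rkN M (insert x B) ≤ rkN M (insert x (insert y B)) :=
    rkN_mono (Finset.insert_subset_insert x (Finset.subset_insert y B))
  omega

/-- **A `(q+1)`-set of rank `q` is closed** in the thin regime: every further point raises the rank. -/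
theorem rkN_insert_eq_succ_of_card_succ {q : ℕ} (hthin : ∀ X ⊆ gr M, rkN M X = q → X.card ≤ q + 1)
    {B : Finset α} (hBg : B ⊆ gr M) (hBc : B.card = q + 1) (hB : rkN M B = q) {x : α} (hx : x ∈ gr M)
    (hxB : x ∉ B) : rkN M (insert x B) = q + 1 := by
  apply rkN_insert_eq_succ_of_ne hB
  intro h
  have := hthin (insert x B) (Finset.insert_subset hx hBg) h
  rw [Finset.card_insert_of_notMem hxB, hBc] at this
  omega

/-- **At most one inner point**: two points `y ≠ y'` outside an independent `q`-set `B` with `ρ(B ∪ {y}) = ρ(B ∪ {y'}) = q`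
would give the rank-`q` set `B ∪ {y, y'}` with `q + 2` points. -/
theorem inner_unique {q : ℕ} (hthin : ∀ X ⊆ gr M, rkN M X = q → X.card ≤ q + 1)
    {B : Finset α} (hBg : B ⊆ gr M) (hBc : B.card = q) (hB : rkN M B = q)
    {y y' : α} (hy : y ∈ gr M) (hyB : y ∉ B) (hy' : y' ∈ gr M) (hy'B : y' ∉ B)
    (hr : rkN M (insert y B) = q) (hr' : rkN M (insert y' B) = q) : y = y' := by
  by_contra hne
  have hsub := rkN_inter_add_union_le (M := M) (insert y B) (insert y' B)
  have hinter : insert y B ∩ insert y' B = B := by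
    ext z
    simp only [Finset.mem_inter, Finset.mem_insert]
    constructor
    · rintro ⟨h1 | h1, h2 | h2⟩
      · exact absurd (h1.symm.trans h2) hne
      · exact h2
      · exact h1
      · exact h1
    · intro h; exact ⟨Or.inr h, Or.inr h⟩
  have hunion : insert y B ∪ insert y' B = insert y (insert y' B) := by
    ext z
    simp only [Finset.mem_union, Finset.mem_insert]
    tauto
  rw [hinter, hunion, hB, hr, hr'] at hsub
  have hmono : rkN M B ≤ rkN M (insert y (insert y' B)) :=
    rkN_mono ((Finset.subset_insert y' B).trans (Finset.subset_insert y _))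
  have hcard : (insert y (insert y' B)).card = q + 2 := by
    rw [Finset.card_insert_of_notMem, Finset.card_insert_of_notMem hy'B, hBc]
    simp only [Finset.mem_insert, not_or]
    exact ⟨hne, hyB⟩
  have := hthin (insert y (insert y' B)) (Finset.insert_subset hy (Finset.insert_subset hy' hBg)) (by omega)
  omega

/-- **The third point of `K` is the inner point of a `2K`-set**: `|B| = q`, `ρ(B) = q`, `|B ∩ K| = 2`, `k ∈ K ∖ B` ⇒ `ρ(B ∪ {k}) = q`. -/
theorem rkN_insert_eq_of_twoK {q : ℕ} {K B : Finset α} (hK3 : K.card = 3) (hKrk : rkN M K = 2)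
    (hBc : B.card = q) (hB : rkN M B = q) (hBK : (B ∩ K).card = 2) {k : α} (hkK : k ∈ K) (hkB : k ∉ B) :
    rkN M (insert k B) = q := by
  have hKB : (K \ B).card = 1 := by have := OneCircuit.card_sdiff_add_card_inter' K B; omega
  have hKsub : K ⊆ insert k B := by
    intro z hz
    by_cases hzB : z ∈ B
    · exact Finset.mem_insert_of_mem hzB
    · have hzKB : z ∈ K \ B := Finset.mem_sdiff.mpr ⟨hz, hzB⟩
      have hkKB : k ∈ K \ B := Finset.mem_sdiff.mpr ⟨hkK, hkB⟩
      obtain ⟨a, ha⟩ := Finset.card_eq_one.mp hKB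
      rw [ha, Finset.mem_singleton] at hzKB hkKB
      rw [hzKB, ← hkKB]
      exact Finset.mem_insert_self k B
  have hEq : insert k B = (B \ K) ∪ K := by
    ext z
    simp only [Finset.mem_insert, Finset.mem_union, Finset.mem_sdiff]
    constructor
    · rintro (rfl | hzB)
      · right; exact hkK
      · by_cases hzK : z ∈ K
        · right; exact hzK
        · left; exact ⟨hzB, hzK⟩
    · rintro (⟨hzB, _⟩ | hzK)
      · right; exact hzB
      · exact Finset.mem_insert.mp (hKsub hzK)
  have h1 : rkN M ((B \ K) ∪ K) ≤ rkN M (B \ K) + rkN M K := OneCircuit.rkN_union_le_add _ _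
  have h2 : rkN M (B \ K) ≤ (B \ K).card := rkN_le_card _
  have h3 : (B \ K).card + (B ∩ K).card = B.card := Finset.card_sdiff_add_card_inter B K
  have h4 : rkN M B ≤ rkN M (insert k B) := rkN_mono (Finset.subset_insert k B)
  rw [hEq] at h4 ⊢
  omega

/-- **Shape `K ⊆ S`, a point of `K`**: for `|S| = q + 2`, `ρ(S) = q + 1` and `c ∈ K`, `ρ(S ∖ {c}) = q + 1` (simplicity: `K ∖ {c}` is an
independent pair). -/
theorem rkN_erase_eq_succ_of_mem {q : ℕ} (hsimple : ∀ X ⊆ gr M, X.card ≤ 2 → rkN M X = X.card)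
    {K S : Finset α} (hKg : K ⊆ gr M) (hK3 : K.card = 3) (hKrk : rkN M K = 2) (hKS : K ⊆ S)
    (hS : rkN M S = q + 1) {c : α} (hcK : c ∈ K) : rkN M (S.erase c) = q + 1 := by
  have hsub := rkN_inter_add_union_le (M := M) (S.erase c) K
  have hinter : S.erase c ∩ K = K.erase c := by
    ext z
    simp only [Finset.mem_inter, Finset.mem_erase]
    constructor
    · rintro ⟨⟨h1, _⟩, h3⟩; exact ⟨h1, h3⟩
    · rintro ⟨h1, h2⟩; exact ⟨⟨h1, hKS h2⟩, h2⟩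
  have hunion : S.erase c ∪ K = S := by
    ext z
    simp only [Finset.mem_union, Finset.mem_erase]
    constructor
    · rintro (⟨_, h⟩ | h)
      · exact h
      · exact hKS h
    · intro h
      by_cases hzc : z = c
      · right; rw [hzc]; exact hcK
      · left; exact ⟨hzc, h⟩
  have hKc : rkN M (K.erase c) = 2 := by
    have hce := Finset.card_erase_of_mem hcK
    rw [hsimple (K.erase c) ((Finset.erase_subset c K).trans hKg) (by omega)]
    omega
  rw [hinter, hunion, hKc, hS, hKrk] at hsub
  have h2 : rkN M (S.erase c) ≤ rkN M S := rkN_mono (Finset.erase_subset c S)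
  omega

/-- **Shape `K ⊆ S`, a point outside `K`**: for `|S| = q + 2`, `ρ(S) = q + 1`, `c ∈ S ∖ K`, `ρ(S ∖ {c}) = q`. -/
theorem rkN_erase_eq_of_notMem {q : ℕ} {K S : Finset α} (hK3 : K.card = 3) (hKrk : rkN M K = 2) (hKS : K ⊆ S)
    (hSc : S.card = q + 2) (hS : rkN M S = q + 1) {c : α} (hcS : c ∈ S) (hcK : c ∉ K) : rkN M (S.erase c) = q := by
  have hKsub : K ⊆ S.erase c := fun z hz => Finset.mem_erase.mpr ⟨fun h => hcK (h ▸ hz), hKS hz⟩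
  have h1 := OneCircuit.rkN_add_one_le_card_of_subset hK3 hKrk hKsub
  have h2 := Finset.card_erase_of_mem hcS
  have h3 : rkN M S ≤ rkN M (S.erase c) + 1 := by
    have := rkN_insert_le (M := M) (X := S.erase c) c
    rw [Finset.insert_erase hcS] at this
    exact this
  omega

/-- **Shape `K ⊄ S`: at most two coloops.** A `(q+2)`-set `S` of rank `q + 1` not containing `K` has at most two points `c` with
`ρ(S ∖ {c}) = q`: three of them would give `T = S ∖ {c₁, c₂, c₃}` of rank `q − 2` with `q − 1` points, and `T ∪ K` (nullity `≥ 2`,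
rank `≤ q`) sits below `S ∪ K` (rank `≥ q + 1`), against `card_le_rkN_add_one_of_between`. -/
theorem card_col_le_two {q : ℕ} (hsimple : ∀ X ⊆ gr M, X.card ≤ 2 → rkN M X = X.card)
    (hthin : ∀ X ⊆ gr M, rkN M X = q → X.card ≤ q + 1)
    {K S : Finset α} (hKg : K ⊆ gr M) (hK3 : K.card = 3) (hKrk : rkN M K = 2) (hSg : S ⊆ gr M)
    (hSc : S.card = q + 2) (hS : rkN M S = q + 1) (hKS : ¬ K ⊆ S) :
    (S.filter (fun c => rkN M (S.erase c) = q)).card ≤ 2 := by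
  by_contra hcon
  push Not at hcon
  obtain ⟨T3, hT3sub, hT3c⟩ := Finset.exists_subset_card_eq
    (show 3 ≤ (S.filter (fun c => rkN M (S.erase c) = q)).card by omega)
  obtain ⟨c₁, c₂, c₃, h12, h13, h23, rfl⟩ := Finset.card_eq_three.mp hT3c
  have hm : ∀ c ∈ ({c₁, c₂, c₃} : Finset α), c ∈ S ∧ rkN M (S.erase c) = q :=
    fun c hc => Finset.mem_filter.mp (hT3sub hc)
  obtain ⟨hc₁S, hr₁⟩ := hm c₁ (by simp)
  obtain ⟨hc₂S, hr₂⟩ := hm c₂ (by simp)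
  obtain ⟨hc₃S, hr₃⟩ := hm c₃ (by simp)
  -- `ρ(S ∖ {c₁, c₂}) ≤ q − 1`
  have hT2r : rkN M ((S.erase c₁).erase c₂) + 1 ≤ q := by
    have hsub := rkN_inter_add_union_le (M := M) (S.erase c₁) (S.erase c₂)
    have hi : S.erase c₁ ∩ S.erase c₂ = (S.erase c₁).erase c₂ := by
      ext z
      simp only [Finset.mem_inter, Finset.mem_erase]
      tauto
    have hu : S.erase c₁ ∪ S.erase c₂ = S := by
      ext z
      simp only [Finset.mem_union, Finset.mem_erase]
      constructor
      · rintro (⟨_, h⟩ | ⟨_, h⟩) <;> exact h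
      · intro h
        by_cases hz : z = c₁
        · right; exact ⟨by rw [hz]; exact h12, h⟩
        · left; exact ⟨hz, h⟩
    rw [hi, hu, hr₁, hr₂, hS] at hsub
    omega
  -- `ρ(S ∖ {c₁, c₂, c₃}) ≤ q − 2`
  have hTr : rkN M (((S.erase c₁).erase c₂).erase c₃) + 2 ≤ q := by
    have hsub := rkN_inter_add_union_le (M := M) ((S.erase c₁).erase c₂) (S.erase c₃)
    have hi : (S.erase c₁).erase c₂ ∩ S.erase c₃ = ((S.erase c₁).erase c₂).erase c₃ := by
      ext z
      simp only [Finset.mem_inter, Finset.mem_erase]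
      tauto
    have hu : (S.erase c₁).erase c₂ ∪ S.erase c₃ = S := by
      ext z
      simp only [Finset.mem_union, Finset.mem_erase]
      constructor
      · rintro (⟨_, _, h⟩ | ⟨_, h⟩) <;> exact h
      · intro h
        by_cases hz3 : z = c₃
        · left; exact ⟨by rw [hz3]; exact h23.symm, by rw [hz3]; exact h13.symm, h⟩
        · right; exact ⟨hz3, h⟩
    rw [hi, hu, hr₃, hS] at hsub
    omega
  have hc₂' : c₂ ∈ S.erase c₁ := Finset.mem_erase.mpr ⟨h12.symm, hc₂S⟩
  have hc₃' : c₃ ∈ (S.erase c₁).erase c₂ := Finset.mem_erase.mpr ⟨h23.symm, Finset.mem_erase.mpr ⟨h13.symm, hc₃S⟩⟩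
  have hTc : (((S.erase c₁).erase c₂).erase c₃).card + 3 = S.card := by
    have e1 := Finset.card_erase_of_mem hc₁S
    have e2 := Finset.card_erase_of_mem hc₂'
    have e3 := Finset.card_erase_of_mem hc₃'
    have : c₁ ∈ S := hc₁S
    have hS1 : 1 ≤ S.card := Finset.card_pos.mpr ⟨c₁, this⟩
    have hS2 : 1 ≤ (S.erase c₁).card := Finset.card_pos.mpr ⟨c₂, hc₂'⟩
    have hS3 : 1 ≤ ((S.erase c₁).erase c₂).card := Finset.card_pos.mpr ⟨c₃, hc₃'⟩
    omega
  have hTS : ((S.erase c₁).erase c₂).erase c₃ ⊆ S :=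
    ((Finset.erase_subset _ _).trans (Finset.erase_subset _ _)).trans (Finset.erase_subset _ _)
  -- `T ∩ K` has at most two points and is independent
  have hSK : (S ∩ K).card ≤ 2 := by
    have h3 : (S ∩ K).card ≤ 3 := (Finset.card_le_card Finset.inter_subset_right).trans hK3.le
    have h4 : (S ∩ K).card ≠ 3 := fun h => hKS ((OneCircuit.subset_iff_card_inter_eq hK3).mpr h)
    omega
  have hTK : ((((S.erase c₁).erase c₂).erase c₃) ∩ K).card ≤ 2 :=
    (Finset.card_le_card (Finset.inter_subset_inter hTS (Finset.Subset.refl K))).trans hSK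
  have hTKr : rkN M ((((S.erase c₁).erase c₂).erase c₃) ∩ K) = ((((S.erase c₁).erase c₂).erase c₃) ∩ K).card :=
    hsimple _ (Finset.inter_subset_right.trans hKg) hTK
  have hsub := rkN_inter_add_union_le (M := M) (((S.erase c₁).erase c₂).erase c₃) K
  rw [hTKr] at hsub
  have hXc := Finset.card_union_add_card_inter (((S.erase c₁).erase c₂).erase c₃) K
  have hXq : rkN M ((((S.erase c₁).erase c₂).erase c₃) ∪ K) ≤ q := by omega
  have hYr : q ≤ rkN M (S ∪ K) := by
    have := rkN_mono (M := M) (Finset.subset_union_left (s₁ := S) (s₂ := K))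
    omega
  have hXY : (((S.erase c₁).erase c₂).erase c₃) ∪ K ⊆ S ∪ K := Finset.union_subset_union hTS (Finset.Subset.refl K)
  have := card_le_rkN_add_one_of_between hthin hXY (Finset.union_subset hSg hKg) hXq hYr
  omega

/-- **Shape `K ⊄ S`: the σ-loaders inject into `col S × (S ∖ col S)`.** For `|S| = q + 2`, `ρ(S) = q + 1`, an independent `q`-subset
`B ⊆ S` with an inner point `y ∈ S ∖ B` (`ρ(B ∪ {y}) = q`) is `S ∖ {x, y}` where `x` is a coloop of `S` (`ρ(S ∖ {x}) = ρ(B ∪ {y}) = q`) and `y`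
is not (`ρ(S ∖ {y}) = q` would force `ρ(B) ≤ q − 1`). -/
theorem mem_image_of_inner {q : ℕ} {S B : Finset α} (hSc : S.card = q + 2) (hS : rkN M S = q + 1) (hBS : B ⊆ S)
    (hBc : B.card = q) (hB : rkN M B = q) {y : α} (hyS : y ∈ S) (hyB : y ∉ B) (hy : rkN M (insert y B) = q) :
    B ∈ ((S.filter (fun c => rkN M (S.erase c) = q)) ×ˢ (S \ S.filter (fun c => rkN M (S.erase c) = q))).image
      (fun p => (S.erase p.1).erase p.2) := by
  have hSB : (S \ B).card = 2 := by rw [Finset.card_sdiff_of_subset hBS]; omega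
  have hySB : y ∈ S \ B := Finset.mem_sdiff.mpr ⟨hyS, hyB⟩
  have hx1 : ((S \ B).erase y).card = 1 := by rw [Finset.card_erase_of_mem hySB, hSB]
  obtain ⟨x, hx⟩ := Finset.card_eq_one.mp hx1
  have hxmem : x ∈ (S \ B).erase y := hx ▸ Finset.mem_singleton_self x
  have hxy : x ≠ y := Finset.ne_of_mem_erase hxmem
  have hxS : x ∈ S := (Finset.mem_sdiff.mp (Finset.mem_of_mem_erase hxmem)).1
  have hxB : x ∉ B := (Finset.mem_sdiff.mp (Finset.mem_of_mem_erase hxmem)).2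
  -- `S ∖ {x} = B ∪ {y}`
  have hSx : S.erase x = insert y B := by
    apply Finset.eq_of_subset_of_card_le
    · intro z hz
      rw [Finset.mem_erase] at hz
      rw [Finset.mem_insert]
      by_cases hzB : z ∈ B
      · right; exact hzB
      · left
        by_contra hzy
        have : z ∈ (S \ B).erase y := Finset.mem_erase.mpr ⟨hzy, Finset.mem_sdiff.mpr ⟨hz.2, hzB⟩⟩
        rw [hx, Finset.mem_singleton] at this
        exact hz.1 this
    · rw [Finset.card_insert_of_notMem hyB, Finset.card_erase_of_mem hxS, hBc, hSc]
      omega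
  have hxcol : x ∈ S.filter (fun c => rkN M (S.erase c) = q) :=
    Finset.mem_filter.mpr ⟨hxS, by rw [hSx]; exact hy⟩
  have hycol : y ∉ S.filter (fun c => rkN M (S.erase c) = q) := by
    intro hyc
    have hyr := (Finset.mem_filter.mp hyc).2
    have hsub := rkN_inter_add_union_le (M := M) (S.erase x) (S.erase y)
    have hi : S.erase x ∩ S.erase y = B := by
      ext z
      simp only [Finset.mem_inter, Finset.mem_erase]
      constructor
      · rintro ⟨⟨hzx, hzS⟩, ⟨hzy, _⟩⟩
        by_contra hzB
        have : z ∈ (S \ B).erase y := Finset.mem_erase.mpr ⟨hzy, Finset.mem_sdiff.mpr ⟨hzS, hzB⟩⟩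
        rw [hx, Finset.mem_singleton] at this
        exact hzx this
      · intro hzB
        exact ⟨⟨fun h => hxB (h ▸ hzB), hBS hzB⟩, ⟨fun h => hyB (h ▸ hzB), hBS hzB⟩⟩
    have hu : S.erase x ∪ S.erase y = S := by
      ext z
      simp only [Finset.mem_union, Finset.mem_erase]
      constructor
      · rintro (⟨_, h⟩ | ⟨_, h⟩) <;> exact h
      · intro h
        by_cases hzx : z = x
        · right; exact ⟨by rw [hzx]; exact hxy, h⟩
        · left; exact ⟨hzx, h⟩
    rw [hi, hu, hSx, hy, hyr, hS, hB] at hsub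
    omega
  refine Finset.mem_image.mpr ⟨(x, y), Finset.mem_product.mpr ⟨hxcol, Finset.mem_sdiff.mpr ⟨hyS, hycol⟩⟩, ?_⟩
  show (S.erase x).erase y = B
  rw [hSx, Finset.erase_insert hyB]

end ThinTriangle
end PercRepro
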